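import Summits.NavierStokesRegularity.FunctionalMining.NoGo.DirectorForm
import HarnessLib

/-!
# FunctionalMining — Danskin's formula for the top Rayleigh value: `(d/dτ)|_{0⁺} λ(A + τM) = μ(A; M)`

Search for candidate a priori estimates; no regularity claim. Cell `pub-nsfunc`, prove seat
(gen 21). Finite-dimensional tool for the dictionary's Lemma L-λ node (`TopEigHeatCoercive.lean`)
and the no-go seat's "exact dissipation calculus of `Φ_q = ∫ λ₁(S)^q`" (F1 PART I, Theorem 1 (c),
kernel candidate K-c): the top Rayleigh value `λ(A) = sup_{|e|=1} eᵀAe` of `TopEigRayleigh.lean` is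
convex, hence has one-sided directional derivatives, and DANSKIN's formula identifies them:

* `TopEig.topEigSet A` — the unit vectors attaining `λ(A)` (for symmetric `A`: the unit top
  eigenvectors); nonempty and compact (the tree's `SharpClass.DirectorForm.isCompact_unitSphere`,
  `TopEig.exists_quad_eq_lam`);
* `TopEig.dirTopEig A M = μ(A; M) := sup {eᵀMe : e ∈ topEigSet A}` — the largest value of the
  quadratic form of `M` on the top eigen-set (attained, `TopEig.exists_quad_eq_dirTopEig`;
  `|μ(A;M)| ≤ ‖M‖`, `μ(A; cA) = c λ(A)`);
* `TopEig.lam_add_smul_ge` — `λ(A) + τ μ(A;M) ≤ λ(A + τM)` for every `τ ≥ 0` (test with a top vector);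
* `TopEig.eventually_lam_add_smul_le` — for every `ε > 0`, `λ(A + τM) ≤ λ(A) + τ (μ(A;M) + ε)` for
  all small `τ > 0` (compactness: the near-top sets `{eᵀAe ≥ λ(A) − 1/(n+1)}` shrink to the top
  eigen-set, Mathlib `exists_subset_nhds_of_isCompact'`);
* **`TopEig.hasDerivWithinAt_lam_line`** — `τ ↦ λ(A + τM)` has right derivative `μ(A; M)` at `τ = 0`.

Everything is elementary and dimension-free (`d` a nonempty finite type). [ours; folklore convex
analysis — Danskin's theorem for a maximum of linear forms over a compact set.]
-/

noncomputable section

open Filter Topology Set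

namespace Summit.NavierStokesRegularity.FunctionalMining

namespace TopEig

section Compact

variable {d : Type*} [Fintype d]

/-! ## 1. Continuity of the Rayleigh form; `λ` is attained (the unit sphere is compact) -/

/-- The Rayleigh form `e ↦ eᵀAe` is continuous. [folklore] -/
theorem continuous_quad (A : EuclideanSpace ℝ (d × d)) : Continuous (quad A) := by
  unfold quad
  fun_prop

/-- The unit sphere `{eᵀe = 1}` is closed (it is compact, `SharpClass.DirectorForm.isCompact_unitSphere`).
[folklore] -/
theorem isClosed_unitSphere : IsClosed (unitSphere d) :=
  SharpClass.DirectorForm.isCompact_unitSphere.isClosed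

/-! ## 2. The top eigen-set and the directional value `μ(A; M)` -/

/-- **The top eigen-set** `E(A) = {e : eᵀe = 1, eᵀAe = λ(A)}`: the unit vectors attaining the top
Rayleigh value (for symmetric `A`, the unit top eigenvectors). [ours, bookkeeping] -/
def topEigSet (A : EuclideanSpace ℝ (d × d)) : Set (d → ℝ) :=
  {e | e ∈ unitSphere d ∧ quad A e = lam A}

/-- Top vectors are unit vectors. [ours, bookkeeping] -/
theorem topEigSet_subset (A : EuclideanSpace ℝ (d × d)) : topEigSet A ⊆ unitSphere d :=
  fun _ he => he.1

/-- The top eigen-set is closed. [folklore] -/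
theorem isClosed_topEigSet (A : EuclideanSpace ℝ (d × d)) : IsClosed (topEigSet A) :=
  isClosed_unitSphere.inter (isClosed_eq (continuous_quad A) continuous_const)

/-- The top eigen-set is compact. [folklore] -/
theorem isCompact_topEigSet (A : EuclideanSpace ℝ (d × d)) : IsCompact (topEigSet A) :=
  SharpClass.DirectorForm.isCompact_unitSphere.of_isClosed_subset (isClosed_topEigSet A)
    (topEigSet_subset A)

/-- **`μ(A; M) = sup {eᵀMe : e ∈ E(A)}`** — the largest value of the quadratic form of `M` on the
top eigen-set of `A` (= the largest eigenvalue of the compression of `M` to the top eigenspace of a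
symmetric `A`). Danskin: the right derivative of `τ ↦ λ(A + τM)` at `0`
(`hasDerivWithinAt_lam_line`). Junk (`sSup ∅`) if `d` is empty. [ours] -/
def dirTopEig (A M : EuclideanSpace ℝ (d × d)) : ℝ := sSup (quad M '' topEigSet A)

/-- The values `eᵀMe` on the top eigen-set are bounded above (by `‖M‖`). [folklore] -/
theorem bddAbove_quad_image_topEigSet (A M : EuclideanSpace ℝ (d × d)) :
    BddAbove (quad M '' topEigSet A) :=
  (bddAbove_quad_image M).mono (image_mono (topEigSet_subset A))

/-- `eᵀMe ≤ μ(A; M)` for every top vector `e` of `A`. [folklore] -/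
theorem quad_le_dirTopEig {A : EuclideanSpace ℝ (d × d)} (M : EuclideanSpace ℝ (d × d)) {e : d → ℝ}
    (he : e ∈ topEigSet A) : quad M e ≤ dirTopEig A M :=
  le_csSup (bddAbove_quad_image_topEigSet A M) ⟨e, he, rfl⟩

end Compact

variable {d : Type*} [Fintype d] [DecidableEq d] [Nonempty d]

/-- **`λ(A)` is attained** on the unit sphere. [folklore] -/
theorem exists_quad_eq_lam (A : EuclideanSpace ℝ (d × d)) : ∃ e ∈ unitSphere d, quad A e = lam A := by
  obtain ⟨e, he, hmax⟩ := SharpClass.DirectorForm.isCompact_unitSphere.exists_isMaxOn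
    unitSphere_nonempty (continuous_quad A).continuousOn
  exact ⟨e, he, le_antisymm (quad_le_lam A he) (lam_le fun f hf => isMaxOn_iff.1 hmax f hf)⟩

/-- The top eigen-set is nonempty. [folklore] -/
theorem topEigSet_nonempty (A : EuclideanSpace ℝ (d × d)) : (topEigSet A).Nonempty :=
  let ⟨e, he, h⟩ := exists_quad_eq_lam A
  ⟨e, he, h⟩

/-- `μ(A; M)` is the least upper bound: a uniform bound on `eᵀMe` over the top eigen-set bounds it.
[folklore] -/
theorem dirTopEig_le {A M : EuclideanSpace ℝ (d × d)} {c : ℝ} (h : ∀ e ∈ topEigSet A, quad M e ≤ c) :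
    dirTopEig A M ≤ c :=
  csSup_le ((topEigSet_nonempty A).image _) (by rintro _ ⟨e, he, rfl⟩; exact h e he)

/-- **`μ(A; M)` is attained** on the top eigen-set. [folklore] -/
theorem exists_quad_eq_dirTopEig (A M : EuclideanSpace ℝ (d × d)) :
    ∃ e ∈ topEigSet A, quad M e = dirTopEig A M := by
  obtain ⟨e, he, hmax⟩ := (isCompact_topEigSet A).exists_isMaxOn (topEigSet_nonempty A)
    (continuous_quad M).continuousOn
  exact ⟨e, he, le_antisymm (quad_le_dirTopEig M he)
    (dirTopEig_le fun f hf => isMaxOn_iff.1 hmax f hf)⟩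

/-- `μ(A; M) ≤ λ(M)`. [folklore] -/
theorem dirTopEig_le_lam (A M : EuclideanSpace ℝ (d × d)) : dirTopEig A M ≤ lam M :=
  dirTopEig_le fun _ he => quad_le_lam M he.1

/-- `μ(A; M) ≤ ‖M‖`. [folklore] -/
theorem dirTopEig_le_norm (A M : EuclideanSpace ℝ (d × d)) : dirTopEig A M ≤ ‖M‖ :=
  (dirTopEig_le_lam A M).trans (lam_le_norm M)

/-- `−‖M‖ ≤ μ(A; M)`. [folklore] -/
theorem neg_norm_le_dirTopEig (A M : EuclideanSpace ℝ (d × d)) : -‖M‖ ≤ dirTopEig A M := by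
  obtain ⟨e, he⟩ := topEigSet_nonempty A
  have h := abs_quad_le M e
  rw [show e ⬝ᵥ e = 1 from he.1, mul_one] at h
  exact (neg_le_of_abs_le h).trans (quad_le_dirTopEig M he)

/-- `|μ(A; M)| ≤ ‖M‖`. [folklore] -/
theorem abs_dirTopEig_le_norm (A M : EuclideanSpace ℝ (d × d)) : |dirTopEig A M| ≤ ‖M‖ :=
  abs_le.2 ⟨neg_norm_le_dirTopEig A M, dirTopEig_le_norm A M⟩

/-- `μ(A; cA) = c λ(A)`: along its own ray the top value moves at speed `λ(A)` (both signs of `c`).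
[folklore] -/
theorem dirTopEig_smul_self (c : ℝ) (A : EuclideanSpace ℝ (d × d)) :
    dirTopEig A (c • A) = c * lam A := by
  have h : quad (c • A) '' topEigSet A = {c * lam A} := by
    refine Set.eq_singleton_iff_nonempty_unique_mem.2 ⟨(topEigSet_nonempty A).image _, ?_⟩
    rintro _ ⟨e, he, rfl⟩
    rw [quad_smul, he.2]
  rw [dirTopEig, h, csSup_singleton]

/-- `μ(A; A) = λ(A)`. [folklore] -/
theorem dirTopEig_self (A : EuclideanSpace ℝ (d × d)) : dirTopEig A A = lam A := by
  simpa using dirTopEig_smul_self 1 A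

/-- Subadditivity in the direction: `μ(A; M + N) ≤ μ(A; M) + μ(A; N)`. [folklore] -/
theorem dirTopEig_add_le (A M N : EuclideanSpace ℝ (d × d)) :
    dirTopEig A (M + N) ≤ dirTopEig A M + dirTopEig A N :=
  dirTopEig_le fun e he => by
    rw [quad_add]; exact add_le_add (quad_le_dirTopEig M he) (quad_le_dirTopEig N he)

/-- Positive homogeneity in the direction: `μ(A; aM) = a μ(A; M)` for `a ≥ 0`. [folklore] -/
theorem dirTopEig_smul_of_nonneg {a : ℝ} (ha : 0 ≤ a) (A M : EuclideanSpace ℝ (d × d)) :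
    dirTopEig A (a • M) = a * dirTopEig A M := by
  refine le_antisymm (dirTopEig_le fun e he => ?_) ?_
  · rw [quad_smul]; exact mul_le_mul_of_nonneg_left (quad_le_dirTopEig M he) ha
  · obtain ⟨e, he, hq⟩ := exists_quad_eq_dirTopEig A M
    rw [← hq, ← quad_smul]
    exact quad_le_dirTopEig (a • M) he

/-! ## 3. Danskin's formula -/

/-- **Lower bound, for every `τ ≥ 0`: `λ(A) + τ μ(A; M) ≤ λ(A + τM)`** (test `A + τM` with a top
vector of `A`). [folklore] -/
theorem lam_add_smul_ge (A M : EuclideanSpace ℝ (d × d)) {τ : ℝ} (hτ : 0 ≤ τ) :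
    lam A + τ * dirTopEig A M ≤ lam (A + τ • M) := by
  rcases eq_or_lt_of_le hτ with rfl | hτ'
  · simp
  · have h : ∀ e ∈ topEigSet A, quad M e ≤ (lam (A + τ • M) - lam A) / τ := by
      intro e he
      rw [le_div_iff₀ hτ', le_sub_iff_add_le]
      have h1 : quad (A + τ • M) e = lam A + τ * quad M e := by rw [quad_add, quad_smul, he.2]
      calc quad M e * τ + lam A = quad (A + τ • M) e := by rw [h1]; ring
        _ ≤ lam (A + τ • M) := quad_le_lam _ he.1
    have h2 := dirTopEig_le h
    rw [le_div_iff₀ hτ'] at h2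
    linarith

/-- **Upper bound, eventually: for every `ε > 0`, `λ(A + τM) ≤ λ(A) + τ (μ(A; M) + ε)` for all
sufficiently small `τ > 0`.** Compactness: the near-top sets `Vₙ = {eᵀe = 1, eᵀAe ≥ λ(A) − 1/(n+1)}`
are compact and decrease to the top eigen-set, on which `eᵀMe ≤ μ < μ + ε`; so some `Vₙ` lies inside
the open set `{eᵀMe < μ + ε}`, and off `Vₙ` the defect `1/(n+1)` in `eᵀAe` absorbs `τ eᵀMe` for small
`τ`. [folklore; Danskin] -/
theorem eventually_lam_add_smul_le (A M : EuclideanSpace ℝ (d × d)) {ε : ℝ} (hε : 0 < ε) :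
    ∀ᶠ τ in 𝓝[>] (0 : ℝ), lam (A + τ • M) ≤ lam A + τ * (dirTopEig A M + ε) := by
  -- the near-top sets
  set V : ℕ → Set (d → ℝ) := fun n =>
    {e | e ∈ unitSphere d ∧ lam A - 1 / ((n : ℝ) + 1) ≤ quad A e} with hV
  have hVanti : ∀ m n : ℕ, m ≤ n → V n ⊆ V m := by
    intro m n hmn e he
    refine ⟨he.1, le_trans ?_ he.2⟩
    have h1 : (1 : ℝ) / ((n : ℝ) + 1) ≤ 1 / ((m : ℝ) + 1) :=
      one_div_le_one_div_of_le (by positivity) (by exact_mod_cast Nat.add_le_add_right hmn 1)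
    linarith
  have hdir : Directed (· ⊇ ·) V := fun m n =>
    ⟨max m n, hVanti _ _ (le_max_left _ _), hVanti _ _ (le_max_right _ _)⟩
  have hVclosed : ∀ n, IsClosed (V n) := fun n =>
    isClosed_unitSphere.inter (isClosed_le continuous_const (continuous_quad A))
  have hVcpt : ∀ n, IsCompact (V n) := fun n =>
    SharpClass.DirectorForm.isCompact_unitSphere.of_isClosed_subset (hVclosed n) fun e he => he.1
  -- their intersection is the top eigen-set
  have hinter : ∀ e ∈ ⋂ n, V n, e ∈ topEigSet A := by
    intro e he
    rw [mem_iInter] at he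
    refine ⟨(he 0).1, le_antisymm (quad_le_lam A (he 0).1) ?_⟩
    refine le_of_forall_pos_lt_add fun δ hδ => ?_
    obtain ⟨n, hn⟩ := exists_nat_one_div_lt hδ
    have h2 := (he n).2
    linarith
  -- `U = {eᵀMe < μ + ε}` is an open neighbourhood of the intersection
  set U : Set (d → ℝ) := {e | quad M e < dirTopEig A M + ε} with hU
  have hUopen : IsOpen U := isOpen_lt (continuous_quad M) continuous_const
  have hUnhds : ∀ e ∈ ⋂ n, V n, U ∈ 𝓝 e := fun e he =>
    hUopen.mem_nhds (by
      have h3 := quad_le_dirTopEig M (hinter e he)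
      show quad M e < dirTopEig A M + ε
      linarith)
  obtain ⟨n, hn⟩ := exists_subset_nhds_of_isCompact' hdir hVcpt hVclosed hUnhds
  -- for `0 < τ < δ / (2‖M‖ + 1)`, `δ = 1/(n+1)`, every unit vector obeys the bound
  set δ : ℝ := 1 / ((n : ℝ) + 1) with hδ
  have hδ0 : 0 < δ := by positivity
  have hc0 : 0 < δ / (2 * ‖M‖ + 1) := by positivity
  filter_upwards [Ioo_mem_nhdsGT hc0] with τ hτ
  have hτ0 : 0 < τ := hτ.1
  have hτ2 : τ * (2 * ‖M‖ + 1) < δ := (lt_div_iff₀ (by positivity)).1 hτ.2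
  have hμ : -‖M‖ ≤ dirTopEig A M := neg_norm_le_dirTopEig A M
  refine lam_le fun e he => ?_
  rw [quad_add, quad_smul]
  by_cases heV : e ∈ V n
  · have h1 : quad M e < dirTopEig A M + ε := hn heV
    have h2 : quad A e ≤ lam A := quad_le_lam A he
    have h3 : τ * quad M e ≤ τ * (dirTopEig A M + ε) := mul_le_mul_of_nonneg_left h1.le hτ0.le
    linarith
  · have h3 : quad A e < lam A - δ := by
      by_contra h4
      exact heV ⟨he, not_lt.1 h4⟩
    have h4 : τ * quad M e ≤ τ * ‖M‖ := mul_le_mul_of_nonneg_left (quad_le_norm M he) hτ0.le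
    have h5 : τ * (-‖M‖) ≤ τ * (dirTopEig A M + ε) :=
      mul_le_mul_of_nonneg_left (by linarith) hτ0.le
    nlinarith [norm_nonneg M]

/-- **Danskin's formula for the top Rayleigh value: `τ ↦ λ(A + τM)` has right derivative `μ(A; M)`
at `τ = 0`**, i.e. `(d/dτ)|_{0⁺} λ₁(A + τM) = max {eᵀMe : e a unit top eigenvector of A}` for
symmetric `A`. [folklore; Danskin] -/
theorem hasDerivWithinAt_lam_line (A M : EuclideanSpace ℝ (d × d)) :
    HasDerivWithinAt (fun τ : ℝ => lam (A + τ • M)) (dirTopEig A M) (Set.Ioi 0) 0 := by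
  have h0 : (0 : ℝ) ∉ Set.Ioi (0 : ℝ) := fun h => lt_irrefl (0 : ℝ) h
  rw [hasDerivWithinAt_iff_tendsto_slope' h0]
  have hslope : ∀ τ : ℝ, 0 < τ →
      slope (fun τ : ℝ => lam (A + τ • M)) 0 τ = (lam (A + τ • M) - lam A) / τ := by
    intro τ _
    rw [slope_def_field, zero_smul, add_zero, sub_zero]
  rw [tendsto_order]
  constructor
  · intro a ha
    filter_upwards [self_mem_nhdsWithin] with τ hτ
    have hτ' : 0 < τ := hτ
    rw [hslope τ hτ', lt_div_iff₀ hτ']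
    have h := lam_add_smul_ge A M hτ'.le
    nlinarith
  · intro b hb
    have hε : 0 < (b - dirTopEig A M) / 2 := by linarith
    filter_upwards [eventually_lam_add_smul_le A M hε, self_mem_nhdsWithin] with τ h1 hτ
    have hτ' : 0 < τ := hτ
    rw [hslope τ hτ', div_lt_iff₀ hτ']
    nlinarith

/-- The right derivative of `τ ↦ λ(A + τM)` at `0` within `(0, ∞)` is `μ(A; M)`. [folklore; Danskin] -/
theorem derivWithin_lam_line (A M : EuclideanSpace ℝ (d × d)) :
    derivWithin (fun τ : ℝ => lam (A + τ • M)) (Set.Ioi 0) 0 = dirTopEig A M :=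
  (hasDerivWithinAt_lam_line A M).derivWithin (uniqueDiffWithinAt_Ioi 0)

/-- The difference quotients converge: `(λ(A + τM) − λ(A))/τ → μ(A; M)` as `τ → 0⁺`.
[folklore; Danskin] -/
theorem tendsto_lam_line_slope (A M : EuclideanSpace ℝ (d × d)) :
    Tendsto (fun τ : ℝ => (lam (A + τ • M) - lam A) / τ) (𝓝[>] 0) (𝓝 (dirTopEig A M)) := by
  have h0 : (0 : ℝ) ∉ Set.Ioi (0 : ℝ) := fun h => lt_irrefl (0 : ℝ) h
  have h := (hasDerivWithinAt_iff_tendsto_slope' h0).1 (hasDerivWithinAt_lam_line A M)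
  refine h.congr' ?_
  filter_upwards [self_mem_nhdsWithin] with τ _
  rw [slope_def_field, zero_smul, add_zero, sub_zero]

end TopEig

end Summit.NavierStokesRegularity.FunctionalMining

end
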